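import Mathlib
import HarnessLib
import Summits.Ventures.LatticeQCDFlow.Exactness.FlowAcceptanceOverlap
import Summits.Ventures.LatticeQCDFlow.Scaling.AutoregressivePathFaithful
import Summits.Ventures.LatticeQCDFlow.Scaling.AutoregressiveGaugePlaquetteReads

/-!
# LatticeQCDFlow / Scaling — THE ACCEPTANCE FORM: an exact sampler driven by a proposal law accepts,
# in equilibrium, at most `1 − ¼ × (mean L¹ distance between the exact conditional and the proposal's
# conditional at any single coordinate)`

HONEST FRAMING: exact (Metropolis-corrected) sampling algorithms for lattice gauge theory;
figures of merit are autocorrelation/cost numbers at stated couplings and volumes; no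
continuum-physics claim.

Venture `LatticeQCDFlow` (cell pub-lqcd), topic `Scaling`, FANOUT row 30 (lean-1, GEN-19) — OUR WORK on
THEORY-2.md §4 row C5: the bridge from the L¹ floors on exact autoregressive conditionals
(`Scaling/AutoregressiveGauge*`: a conditioner blind at one endpoint of a link is no better than the
flat Haar law; the flat law is at Wilson-average total variation `≥ ⟨W₁ₓ₁⟩/2` from the exact one-staple
conditional) to the venture's figure of merit, the EQUILIBRIUM ACCEPTANCE RATE of the exact
(independence-Metropolis-corrected) sampler.

## Setting

`ι` a finite index set (links / sites), `(X, μ)` a probability space (`G` with Haar), `π = ⊗_ι μ` on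
`Ω = ι → X`, `A_s = coordAvg μ s` (integrate out the coordinates in `s` — "generated after").
TARGET: a bounded measurable weight `F ≥ 0` with `Z = ∫ F dπ > 0` (density `p = F/Z`); for a
coordinate `a` and a set `s` of coordinates, `N = A_s F` and `M = A_{insert a s} F`: under `p` the
coordinates off `insert a s` (the CONTEXT, generated before `a`) have density `M/Z` and the exact
conditional density of `ω_a` given them is `N/M` (tree `integral_mul_coordAvg_eq`).
PROPOSAL: a bounded measurable probability density `Q ≥ 0` on `Ω` (`∫ Q dπ = 1`) whose conditional at
`a` given the context is `q`: `A_s Q = q · A_{insert a s} Q`, `q ≥ 0` bounded measurable with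
`∫ q(ω[a ↦ v]) dμ(v) = 1`.  (This is no restriction — the companion file
`Scaling/AutoregressiveProposalAcceptanceInstances` shows that the own conditional
`A_s Q / A_{insert a s} Q` of every proposal density bounded away from `0` and `∞` qualifies, and that
for an autoregressive product `R·q·T` — earlier conditionals · the conditional at `a` · later
conditionals — `q` itself qualifies.)

## What is proved (all [ours]; elementary over the parents)

* §1 toolbox for `A_s` on bounded measurable functions (general index type; the tree had the
  `GaugeConfig` and the continuous versions): `A_s(f − g)`, `A_s(c·f)`, `|A_s h| ≤ A_s|h|`,
  `∫ Φ·h dπ = ∫ Φ·A_s h dπ` for `Φ` blind to `s`, `∫ A_s h = ∫ h`, **`∫|A_s h| dπ ≤ ∫|h| dπ`**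
  (`A_s` is an `L¹`-contraction), `∫ Φ·q dπ = ∫ Φ dπ` for `Φ` blind to `a` and `q` normalised in
  `a`, `A_{insert a s} h (ω[a ↦ v]) = A_{insert a s} h (ω)`.
* §2 **THE CHAIN RULE** `integral_abs_condMarginal_sub_le`:
  `∫ |A_s F − q·A_{insert a s} F| dπ ≤ 2 ∫ |F − Q| dπ` — the `π`-integrated `L¹` distance between the
  exact conditional at `a` and the proposal's conditional at `a` (weighted by the exact context law)
  is at most twice the `L¹` distance of the joint laws.  (`A_s F − q A_{insert a s}F =
  A_s(F − Q) + q·A_{insert a s}(Q − F)`; contraction; the factor `q` integrates away.)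
* §3 **THE ACCEPTANCE FORM** `meanAccept_le_of_condProposal`: Scheffé's identity
  `∫ min(p, Q) = 1 − ½∫|p − Q|` and the tree's `Exactness.meanAccept_le_overlap` (`ā ≤ ∫ min(p, Q)`)
  give, for the equilibrium acceptance rate `ā = ∫∫ min(p(x)Q(y), p(y)Q(x)) dπ dπ` of the independence
  Metropolis sampler with target `p = F/Z` and proposal `Q`:
  `ā ≤ 1 − ½∫|F/Z − Q| dπ ≤ 1 − (1/(4Z)) ∫ |A_s F − q·A_{insert a s} F| dπ`.

READING (value-free): whatever the architecture, an exact sampler that proposes whole configurations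
from a law whose conditional at ONE coordinate is, on average over the exact context law, at `L¹`
distance `δ·Z` from the exact conditional (`δ = Z⁻¹∫|A_sF − q A_{insert a s}F| dπ`, twice the mean total
variation) rejects at least `δ/4` of its proposals in equilibrium.  With the cell's gauge floors
(vertex-blind `q` ⇒ `δ ≥ Z⁻¹∫|A_sF − A_{insert a s}F| ≥ ⟨(1/N) Re tr U_p⟩_β`, every volume) this is a
volume-uniform acceptance ceiling `1 − ⟨W₁ₓ₁⟩_β/4` — typed in a separate file once those parents are
built.  NOT CLAIMED: the sharp constant (`¼` comes from one triangle inequality); anything about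
autocorrelation times beyond the acceptance; unbounded proposal densities.  No `def`, no `sorry`,
nothing cited as a fact.
-/

noncomputable section

namespace Summit.Ventures.LatticeQCDFlow.Theory2.Autoregressive

open MeasureTheory Function Set
open Summit.Ventures.LatticeQCDFlow.Exactness

variable {ι : Type*} [Fintype ι] [DecidableEq ι] {X : Type*} [MeasurableSpace X]
variable (μ : Measure X) [IsProbabilityMeasure μ]

/-! ## §1 Toolbox: `A_s` on bounded measurable functions -/

omit [DecidableEq ι] [IsProbabilityMeasure μ] in
/-- Bounded measurable functions on the product are integrable for `π = ⊗μ` (finite `μ`). [ours] -/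
theorem integrable_pi_of_abs_le [IsFiniteMeasure μ] {h : (ι → X) → ℝ} (hm : Measurable h) {C : ℝ}
    (hb : ∀ ω, |h ω| ≤ C) : Integrable h (Measure.pi fun _ : ι => μ) :=
  Integrable.mono' (integrable_const C) hm.aestronglyMeasurable
    (ae_of_all _ fun ω => by rw [Real.norm_eq_abs]; exact hb ω)

omit [IsProbabilityMeasure μ] in
/-- Sections of a bounded measurable function along `s` are integrable. [ours] -/
theorem integrable_section_of_abs_le [IsFiniteMeasure μ] (s : Finset ι) {h : (ι → X) → ℝ}
    (hm : Measurable h) {C : ℝ} (hb : ∀ ω, |h ω| ≤ C) (ω : ι → X) :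
    Integrable (fun ω' : ι → X => h (s.piecewise ω' ω)) (Measure.pi fun _ : ι => μ) :=
  integrable_pi_of_abs_le μ (hm.comp (measurable_piecewise_left s ω)) fun _ => hb _

omit [IsProbabilityMeasure μ] in
/-- **`A_s (f − g) = A_s f − A_s g`** for bounded measurable `f, g`. [ours] -/
theorem coordAvg_sub_of_abs_le [IsFiniteMeasure μ] (s : Finset ι) {f g : (ι → X) → ℝ}
    (hfm : Measurable f) {Cf : ℝ} (hfb : ∀ ω, |f ω| ≤ Cf) (hgm : Measurable g) {Cg : ℝ}
    (hgb : ∀ ω, |g ω| ≤ Cg) (ω : ι → X) :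
    coordAvg μ s (fun η => f η - g η) ω = coordAvg μ s f ω - coordAvg μ s g ω := by
  unfold coordAvg
  exact integral_sub (integrable_section_of_abs_le μ s hfm hfb ω)
    (integrable_section_of_abs_le μ s hgm hgb ω)

omit [IsProbabilityMeasure μ] in
/-- `A_s (c·f) = c·A_s f`. [ours] -/
theorem coordAvg_const_mul (s : Finset ι) (c : ℝ) (f : (ι → X) → ℝ) (ω : ι → X) :
    coordAvg μ s (fun η => c * f η) ω = c * coordAvg μ s f ω := by
  unfold coordAvg
  exact integral_const_mul c _

omit [IsProbabilityMeasure μ] in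
/-- **`|A_s h| ≤ A_s |h|`.** [ours] -/
theorem abs_coordAvg_le (s : Finset ι) (h : (ι → X) → ℝ) (ω : ι → X) :
    |coordAvg μ s h ω| ≤ coordAvg μ s (fun η => |h η|) ω := by
  unfold coordAvg
  exact abs_integral_le_integral_abs

/-- `|h| ≤ C` everywhere implies `|A_s h| ≤ C` everywhere. [ours] -/
theorem abs_coordAvg_le_of_abs_le (s : Finset ι) {h : (ι → X) → ℝ} (hm : Measurable h) {C : ℝ}
    (hb : ∀ ω, |h ω| ≤ C) (ω : ι → X) : |coordAvg μ s h ω| ≤ C :=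
  abs_le.2 (coordAvg_mem_Icc μ s hm (fun η => (abs_le.1 (hb η)).1) (fun η => (abs_le.1 (hb η)).2) ω)

/-- **`A_s h` is the conditional expectation of `h` given the coordinates off `s`** (general index
type; the tree's `integral_mul_coordAvg_eq` is the `GaugeConfig` case): for bounded measurable `h` and
bounded measurable `Φ` blind to the coordinates of `s`, `∫ Φ·h dπ = ∫ Φ·(A_s h) dπ`. [ours] -/
theorem pi_integral_mul_coordAvg (s : Finset ι) {h Φ : (ι → X) → ℝ} (hm : Measurable h) {C : ℝ}
    (hb : ∀ ω, |h ω| ≤ C) (hΦm : Measurable Φ) {CΦ : ℝ} (hΦb : ∀ ω, |Φ ω| ≤ CΦ)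
    (hΦs : ∀ ω ω', Φ (s.piecewise ω' ω) = Φ ω) :
    ∫ ω, Φ ω * h ω ∂Measure.pi (fun _ : ι => μ) =
      ∫ ω, Φ ω * coordAvg μ s h ω ∂Measure.pi (fun _ : ι => μ) := by
  have hglue : Measurable fun p : (ι → X) × (ι → X) => s.piecewise p.2 p.1 :=
    measurable_piecewise_prod s
  have hint : Integrable (fun p : (ι → X) × (ι → X) => Φ (s.piecewise p.2 p.1) * h (s.piecewise p.2 p.1))
      ((Measure.pi (fun _ : ι => μ)).prod (Measure.pi (fun _ : ι => μ))) := by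
    refine Integrable.mono' (integrable_const (CΦ * C)) ?_ (ae_of_all _ fun p => ?_)
    · exact ((hΦm.comp hglue).mul (hm.comp hglue)).aestronglyMeasurable
    · rw [Real.norm_eq_abs, abs_mul]
      exact mul_le_mul (hΦb _) (hb _) (abs_nonneg _) ((abs_nonneg _).trans (hΦb (s.piecewise p.2 p.1)))
  have hL : ∫ ω, Φ ω * h ω ∂Measure.pi (fun _ : ι => μ) =
      ∫ p, Φ (s.piecewise p.2 p.1) * h (s.piecewise p.2 p.1)
        ∂((Measure.pi (fun _ : ι => μ)).prod (Measure.pi (fun _ : ι => μ))) := by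
    have hmeas : AEStronglyMeasurable (fun ω : ι → X => Φ ω * h ω)
        (Measure.map (fun p : (ι → X) × (ι → X) => s.piecewise p.2 p.1)
          ((Measure.pi (fun _ : ι => μ)).prod (Measure.pi (fun _ : ι => μ)))) :=
      (hΦm.mul hm).aestronglyMeasurable
    conv_lhs => rw [← map_piecewise_pi_prod μ s]
    rw [integral_map (f := fun ω : ι → X => Φ ω * h ω) hglue.aemeasurable hmeas]
  rw [hL, integral_prod _ hint]
  refine integral_congr_ae (ae_of_all _ fun ω => ?_)
  simp only [hΦs]
  rw [integral_const_mul]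
  rfl

/-- **Total mass is preserved**: `∫ A_s h dπ = ∫ h dπ` for bounded measurable `h`. [ours] -/
theorem pi_integral_coordAvg (s : Finset ι) {h : (ι → X) → ℝ} (hm : Measurable h) {C : ℝ}
    (hb : ∀ ω, |h ω| ≤ C) :
    ∫ ω, coordAvg μ s h ω ∂Measure.pi (fun _ : ι => μ) = ∫ ω, h ω ∂Measure.pi (fun _ : ι => μ) := by
  have e := pi_integral_mul_coordAvg μ s hm hb (Φ := fun _ => (1 : ℝ)) measurable_const
    (CΦ := 1) (fun _ => by simp) (fun _ _ => rfl)
  simpa using e.symm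

/-- **`A_s` is an `L¹(π)`-contraction**: `∫ |A_s h| dπ ≤ ∫ |h| dπ`. [ours] -/
theorem pi_integral_abs_coordAvg_le (s : Finset ι) {h : (ι → X) → ℝ} (hm : Measurable h) {C : ℝ}
    (hb : ∀ ω, |h ω| ≤ C) :
    ∫ ω, |coordAvg μ s h ω| ∂Measure.pi (fun _ : ι => μ) ≤ ∫ ω, |h ω| ∂Measure.pi (fun _ : ι => μ) := by
  have habs_m : Measurable fun η => |h η| := hm.abs
  have habs_b : ∀ ω, |(fun η => |h η|) ω| ≤ C := fun ω => by simpa only [abs_abs] using hb ω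
  calc ∫ ω, |coordAvg μ s h ω| ∂Measure.pi (fun _ : ι => μ)
      ≤ ∫ ω, coordAvg μ s (fun η => |h η|) ω ∂Measure.pi (fun _ : ι => μ) := by
        refine integral_mono ?_ ?_ (fun ω => abs_coordAvg_le μ s h ω)
        · exact integrable_pi_of_abs_le μ (measurable_coordAvg μ s hm).abs
            (C := C) (fun ω => by rw [abs_abs]; exact abs_coordAvg_le_of_abs_le μ s hm hb ω)
        · exact integrable_pi_of_abs_le μ (measurable_coordAvg μ s habs_m)
            (fun ω => abs_coordAvg_le_of_abs_le μ s habs_m habs_b ω)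
    _ = ∫ ω, |h ω| ∂Measure.pi (fun _ : ι => μ) := pi_integral_coordAvg μ s habs_m habs_b

/-- **A factor normalised in the coordinate `a` integrates away against anything blind to `a`**:
`∫ Φ·q dπ = ∫ Φ dπ` when `Φ(ω[a ↦ v]) = Φ(ω)` and `∫ q(ω[a ↦ v]) dμ(v) = 1`. [ours] -/
theorem pi_integral_mul_eq_of_normalised {a : ι} {q Φ : (ι → X) → ℝ} (hqm : Measurable q) {Cq : ℝ}
    (hqb : ∀ ω, |q ω| ≤ Cq) (hq1 : ∀ ω, ∫ v, q (update ω a v) ∂μ = 1)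
    (hΦm : Measurable Φ) {CΦ : ℝ} (hΦb : ∀ ω, |Φ ω| ≤ CΦ) (hΦa : ∀ ω v, Φ (update ω a v) = Φ ω) :
    ∫ ω, Φ ω * q ω ∂Measure.pi (fun _ : ι => μ) = ∫ ω, Φ ω ∂Measure.pi (fun _ : ι => μ) := by
  have hblind : ∀ ω ω', Φ (({a} : Finset ι).piecewise ω' ω) = Φ ω := fun ω ω' => by
    rw [Finset.piecewise_singleton]; exact hΦa ω (ω' a)
  rw [pi_integral_mul_coordAvg μ {a} hqm hqb hΦm hΦb hblind]
  refine integral_congr_ae (ae_of_all _ fun ω => ?_)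
  show Φ ω * coordAvg μ {a} q ω = Φ ω
  rw [coordAvg_singleton_of_measurable μ a hqm ω, hq1 ω, mul_one]

omit [IsProbabilityMeasure μ] in
/-- `A_{insert a s} h` does not read the coordinate `a`. [ours] -/
theorem coordAvg_insert_update (s : Finset ι) (a : ι) (h : (ι → X) → ℝ) (ω : ι → X) (v : X) :
    coordAvg μ (insert a s) h (update ω a v) = coordAvg μ (insert a s) h ω := by
  unfold coordAvg
  congr 1
  funext ω'
  rw [Finset.update_eq_piecewise, Finset.piecewise_piecewise_of_subset_right
    (Finset.singleton_subset_iff.2 (Finset.mem_insert_self a s))]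

/-! ## §2 The chain rule: joint `L¹` distance dominates the conditional one at any coordinate -/

/-- **THE CHAIN RULE.**  Target weight `F`, proposal density `Q`, both bounded measurable; `q ≥ 0`
bounded measurable, normalised in the coordinate `a`, and THE PROPOSAL'S CONDITIONAL AT `a`:
`A_s Q = q · A_{insert a s} Q`.  Then
`∫ |A_s F − q·A_{insert a s} F| dπ ≤ 2 ∫ |F − Q| dπ`. [ours] -/
theorem integral_abs_condMarginal_sub_le (s : Finset ι) {a : ι} {F Q q : (ι → X) → ℝ}
    (hFm : Measurable F) {CF : ℝ} (hFb : ∀ ω, |F ω| ≤ CF)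
    (hQm : Measurable Q) {CQ : ℝ} (hQb : ∀ ω, |Q ω| ≤ CQ)
    (hqm : Measurable q) (hq0 : ∀ ω, 0 ≤ q ω) {Cq : ℝ} (hqb : ∀ ω, q ω ≤ Cq)
    (hq1 : ∀ ω, ∫ v, q (update ω a v) ∂μ = 1)
    (hfac : ∀ ω, coordAvg μ s Q ω = q ω * coordAvg μ (insert a s) Q ω) :
    ∫ ω, |coordAvg μ s F ω - q ω * coordAvg μ (insert a s) F ω| ∂Measure.pi (fun _ : ι => μ)
      ≤ 2 * ∫ ω, |F ω - Q ω| ∂Measure.pi (fun _ : ι => μ) := by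
  have hqabs : ∀ ω, |q ω| ≤ Cq := fun ω => by rw [abs_of_nonneg (hq0 ω)]; exact hqb ω
  -- the difference `D = F − Q`
  have hDm : Measurable fun η => F η - Q η := hFm.sub hQm
  have hDb : ∀ ω, |(fun η => F η - Q η) ω| ≤ CF + CQ := fun ω => by
    calc |F ω - Q ω| ≤ |F ω| + |Q ω| := abs_sub _ _
      _ ≤ CF + CQ := add_le_add (hFb ω) (hQb ω)
  set D : (ι → X) → ℝ := fun η => F η - Q η with hDdef
  -- the `A_{insert a s}`-average of `D`, in absolute value: measurable, bounded, blind to `a`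
  set Ψ : (ι → X) → ℝ := fun ω => |coordAvg μ (insert a s) D ω| with hΨdef
  have hΨm : Measurable Ψ := (measurable_coordAvg μ (insert a s) hDm).abs
  have hΨb : ∀ ω, |Ψ ω| ≤ CF + CQ := fun ω => by
    rw [hΨdef, abs_abs]; exact abs_coordAvg_le_of_abs_le μ (insert a s) hDm hDb ω
  have hΨa : ∀ ω v, Ψ (update ω a v) = Ψ ω := fun ω v => by
    simp only [hΨdef]
    rw [coordAvg_insert_update]
  -- pointwise decomposition
  have hpt : ∀ ω, |coordAvg μ s F ω - q ω * coordAvg μ (insert a s) F ω|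
      ≤ |coordAvg μ s D ω| + Ψ ω * q ω := by
    intro ω
    have e1 : coordAvg μ s D ω = coordAvg μ s F ω - coordAvg μ s Q ω :=
      coordAvg_sub_of_abs_le μ s hFm hFb hQm hQb ω
    have e2 : coordAvg μ (insert a s) D ω =
        coordAvg μ (insert a s) F ω - coordAvg μ (insert a s) Q ω :=
      coordAvg_sub_of_abs_le μ (insert a s) hFm hFb hQm hQb ω
    have e3 : coordAvg μ s F ω - q ω * coordAvg μ (insert a s) F ω
        = coordAvg μ s D ω + q ω * (-(coordAvg μ (insert a s) D ω)) := by
      rw [e1, e2, hfac ω]; ring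
    rw [e3]
    calc |coordAvg μ s D ω + q ω * -coordAvg μ (insert a s) D ω|
        ≤ |coordAvg μ s D ω| + |q ω * -coordAvg μ (insert a s) D ω| := abs_add_le _ _
      _ = |coordAvg μ s D ω| + Ψ ω * q ω := by
          rw [abs_mul, abs_neg, abs_of_nonneg (hq0 ω), hΨdef, mul_comm]
  -- integrate
  have hI1 : Integrable (fun ω => |coordAvg μ s D ω|) (Measure.pi fun _ : ι => μ) :=
    integrable_pi_of_abs_le μ (measurable_coordAvg μ s hDm).abs (C := CF + CQ)
      (fun ω => by rw [abs_abs]; exact abs_coordAvg_le_of_abs_le μ s hDm hDb ω)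
  have hI2 : Integrable (fun ω => Ψ ω * q ω) (Measure.pi fun _ : ι => μ) :=
    integrable_pi_of_abs_le μ (hΨm.mul hqm) (C := (CF + CQ) * Cq) (fun ω => by
      rw [abs_mul]
      exact mul_le_mul (hΨb ω) (hqabs ω) (abs_nonneg _) ((abs_nonneg _).trans (hΨb ω)))
  have hI0 : Integrable (fun ω => |coordAvg μ s F ω - q ω * coordAvg μ (insert a s) F ω|)
      (Measure.pi fun _ : ι => μ) := by
    refine integrable_pi_of_abs_le μ ?_ (C := CF + Cq * CF) (fun ω => ?_)
    · exact ((measurable_coordAvg μ s hFm).sub (hqm.mul (measurable_coordAvg μ (insert a s) hFm))).abs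
    · rw [abs_abs]
      calc |coordAvg μ s F ω - q ω * coordAvg μ (insert a s) F ω|
          ≤ |coordAvg μ s F ω| + |q ω * coordAvg μ (insert a s) F ω| := abs_sub _ _
        _ ≤ CF + Cq * CF := by
            rw [abs_mul]
            exact add_le_add (abs_coordAvg_le_of_abs_le μ s hFm hFb ω)
              (mul_le_mul (hqabs ω) (abs_coordAvg_le_of_abs_le μ (insert a s) hFm hFb ω)
                (abs_nonneg _) ((abs_nonneg _).trans (hqabs ω)))
  have hstep1 : ∫ ω, |coordAvg μ s F ω - q ω * coordAvg μ (insert a s) F ω| ∂Measure.pi (fun _ : ι => μ)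
      ≤ ∫ ω, |coordAvg μ s D ω| ∂Measure.pi (fun _ : ι => μ)
          + ∫ ω, Ψ ω * q ω ∂Measure.pi (fun _ : ι => μ) := by
    rw [← integral_add hI1 hI2]
    exact integral_mono hI0 (hI1.add hI2) hpt
  have hA : ∫ ω, |coordAvg μ s D ω| ∂Measure.pi (fun _ : ι => μ)
      ≤ ∫ ω, |D ω| ∂Measure.pi (fun _ : ι => μ) := pi_integral_abs_coordAvg_le μ s hDm hDb
  have hB : ∫ ω, Ψ ω * q ω ∂Measure.pi (fun _ : ι => μ) ≤ ∫ ω, |D ω| ∂Measure.pi (fun _ : ι => μ) := by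
    rw [pi_integral_mul_eq_of_normalised μ hqm hqabs hq1 hΨm hΨb hΨa]
    exact pi_integral_abs_coordAvg_le μ (insert a s) hDm hDb
  have hD : ∫ ω, |D ω| ∂Measure.pi (fun _ : ι => μ) = ∫ ω, |F ω - Q ω| ∂Measure.pi (fun _ : ι => μ) := rfl
  linarith

/-! ## §3 The acceptance form -/

/-- **Scheffé's identity**: for two probability densities, `∫ min(p, Q) = 1 − ½ ∫ |p − Q|`. [folklore] -/
theorem integral_min_eq_one_sub_half_integral_abs {Ω : Type*} [MeasurableSpace Ω] {ν : Measure Ω}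
    {p Q : Ω → ℝ} (hpi : Integrable p ν) (hQi : Integrable Q ν) (hp1 : ∫ x, p x ∂ν = 1)
    (hQ1 : ∫ x, Q x ∂ν = 1) :
    ∫ x, min (p x) (Q x) ∂ν = 1 - (1 / 2) * ∫ x, |p x - Q x| ∂ν := by
  have hmin : ∀ x, min (p x) (Q x) = (1 / 2) * ((p x + Q x) - |p x - Q x|) := by
    intro x
    rcases le_total (p x) (Q x) with h | h
    · rw [min_eq_left h, abs_of_nonpos (sub_nonpos.2 h)]; ring
    · rw [min_eq_right h, abs_of_nonneg (sub_nonneg.2 h)]; ring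
  have hadd : Integrable (fun x => p x + Q x) ν := hpi.add hQi
  have habs : Integrable (fun x => |p x - Q x|) ν := (hpi.sub hQi).abs
  simp_rw [hmin]
  rw [integral_const_mul, integral_sub hadd habs, integral_add hpi hQi, hp1, hQ1]
  ring

/-- **THE ACCEPTANCE FORM.**  Target weight `F ≥ 0` bounded measurable with `Z = ∫ F dπ > 0`;
proposal density `Q ≥ 0` bounded measurable with `∫ Q dπ = 1`, whose conditional at the coordinate `a`
given the context off `insert a s` is `q` (`A_s Q = q·A_{insert a s} Q`, `q ≥ 0` bounded measurable,
normalised in `a`).  The equilibrium acceptance rate of the independence Metropolis sampler with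
target `F/Z` and proposal `Q` satisfies
`∫∫ min((F(x)/Z) Q(y), (F(y)/Z) Q(x)) dπ dπ ≤ 1 − (1/(4Z)) ∫ |A_s F − q·A_{insert a s} F| dπ`. [ours] -/
theorem meanAccept_le_of_condProposal (s : Finset ι) {a : ι} {F Q q : (ι → X) → ℝ}
    (hFm : Measurable F) (hF0 : ∀ ω, 0 ≤ F ω) {CF : ℝ} (hFb : ∀ ω, F ω ≤ CF)
    (hZ : 0 < ∫ ω, F ω ∂Measure.pi (fun _ : ι => μ))
    (hQm : Measurable Q) (hQ0 : ∀ ω, 0 ≤ Q ω) {CQ : ℝ} (hQb : ∀ ω, Q ω ≤ CQ)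
    (hQ1 : ∫ ω, Q ω ∂Measure.pi (fun _ : ι => μ) = 1)
    (hqm : Measurable q) (hq0 : ∀ ω, 0 ≤ q ω) {Cq : ℝ} (hqb : ∀ ω, q ω ≤ Cq)
    (hq1 : ∀ ω, ∫ v, q (update ω a v) ∂μ = 1)
    (hfac : ∀ ω, coordAvg μ s Q ω = q ω * coordAvg μ (insert a s) Q ω) :
    ∫ x, ∫ y, min (F x / (∫ ω, F ω ∂Measure.pi (fun _ : ι => μ)) * Q y)
        (F y / (∫ ω, F ω ∂Measure.pi (fun _ : ι => μ)) * Q x)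
        ∂Measure.pi (fun _ : ι => μ) ∂Measure.pi (fun _ : ι => μ)
      ≤ 1 - 1 / (4 * ∫ ω, F ω ∂Measure.pi (fun _ : ι => μ)) *
          ∫ ω, |coordAvg μ s F ω - q ω * coordAvg μ (insert a s) F ω| ∂Measure.pi (fun _ : ι => μ) := by
  set Z : ℝ := ∫ ω, F ω ∂Measure.pi (fun _ : ι => μ) with hZdef
  have hFabs : ∀ ω, |F ω| ≤ CF := fun ω => by rw [abs_of_nonneg (hF0 ω)]; exact hFb ω
  have hQabs : ∀ ω, |Q ω| ≤ CQ := fun ω => by rw [abs_of_nonneg (hQ0 ω)]; exact hQb ω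
  -- the normalised target `p = F/Z`
  have hpm : Measurable fun ω => F ω / Z := hFm.div_const Z
  have hp0 : ∀ ω, 0 ≤ F ω / Z := fun ω => div_nonneg (hF0 ω) hZ.le
  have hpabs : ∀ ω, |F ω / Z| ≤ CF / Z := fun ω => by
    rw [abs_of_nonneg (hp0 ω)]; exact div_le_div_of_nonneg_right (hFb ω) hZ.le
  have hpi : Integrable (fun ω => F ω / Z) (Measure.pi fun _ : ι => μ) :=
    integrable_pi_of_abs_le μ hpm hpabs
  have hp1 : ∫ ω, F ω / Z ∂Measure.pi (fun _ : ι => μ) = 1 := by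
    rw [integral_div, ← hZdef, div_self hZ.ne']
  have hQi : Integrable Q (Measure.pi fun _ : ι => μ) := integrable_pi_of_abs_le μ hQm hQabs
  -- (i) `ā ≤ ∫ min(p, Q)` (tree) and Scheffé
  have h1 := meanAccept_le_overlap (μ := Measure.pi fun _ : ι => μ) hp0 hpm hpi hp1 hQ0 hQm hQi hQ1
  have h2 := integral_min_eq_one_sub_half_integral_abs hpi hQi hp1 hQ1
  -- (ii) the chain rule for `p` and `Q`
  have h3 := integral_abs_condMarginal_sub_le μ s hpm hpabs hQm hQabs hqm hq0 hqb hq1 hfac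
  -- (iii) `A_t p = (A_t F)/Z`
  have hsc : ∀ (t : Finset ι) (ω : ι → X), coordAvg μ t (fun η => F η / Z) ω = Z⁻¹ * coordAvg μ t F ω := by
    intro t ω
    rw [← coordAvg_const_mul μ t Z⁻¹ F ω]
    congr 1
    funext η
    rw [div_eq_inv_mul]
  have h4 : ∫ ω, |coordAvg μ s (fun η => F η / Z) ω - q ω * coordAvg μ (insert a s) (fun η => F η / Z) ω|
        ∂Measure.pi (fun _ : ι => μ)
      = Z⁻¹ * ∫ ω, |coordAvg μ s F ω - q ω * coordAvg μ (insert a s) F ω| ∂Measure.pi (fun _ : ι => μ) := by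
    rw [← integral_const_mul]
    refine integral_congr_ae (ae_of_all _ fun ω => ?_)
    simp only [hsc]
    rw [show Z⁻¹ * coordAvg μ s F ω - q ω * (Z⁻¹ * coordAvg μ (insert a s) F ω)
        = Z⁻¹ * (coordAvg μ s F ω - q ω * coordAvg μ (insert a s) F ω) by ring, abs_mul,
      abs_of_pos (inv_pos.2 hZ)]
  rw [h4] at h3
  have hI0 : 0 ≤ ∫ ω, |coordAvg μ s F ω - q ω * coordAvg μ (insert a s) F ω| ∂Measure.pi (fun _ : ι => μ) :=
    integral_nonneg fun ω => abs_nonneg _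
  have hkey : 1 / (4 * Z) * ∫ ω, |coordAvg μ s F ω - q ω * coordAvg μ (insert a s) F ω|
        ∂Measure.pi (fun _ : ι => μ)
      ≤ (1 / 2) * ∫ ω, |F ω / Z - Q ω| ∂Measure.pi (fun _ : ι => μ) := by
    rw [show 1 / (4 * Z) * ∫ ω, |coordAvg μ s F ω - q ω * coordAvg μ (insert a s) F ω|
          ∂Measure.pi (fun _ : ι => μ)
        = (1 / 4) * (Z⁻¹ * ∫ ω, |coordAvg μ s F ω - q ω * coordAvg μ (insert a s) F ω|
          ∂Measure.pi (fun _ : ι => μ)) by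
      ring]
    linarith
  linarith

end Summit.Ventures.LatticeQCDFlow.Theory2.Autoregressive

end
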